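import Summits.AnomalousDissipation.AnomalousDissipation.Theorems.SolenoidalFractalHomogenisationLagrangianStepFrameMeasure
import Summits.AnomalousDissipation.AnomalousDissipation.Theorems.SolenoidalFractalHomogenisationLagrangianRenormalisationStepExistsL
import Literature.Analysis.FluidPDE.LagrangianLatticeCarrierFrameChainRule
import Literature.Analysis.FluidPDE.LagrangianLatticeCarrierFrame
import Literature.Analysis.FunctionSpaces.TorusVectorParseval
import HarnessLib

/-!
# K1L_D (stmt-AnomalousDissipation-27980), line «onelevel-design», brick Z6-T: the TRANSPORT TERM of the window cross density IN THE FRAME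
# of the coarse window flow (helper; `--supports … --as helper`; lead-k1l-onelevel-p1 g4)

Z1-op on the carrier (`…LagrangianStepWindowDualityE.inner_sub_eq_setIntegral_cross_level_eddy`, p680494) writes the one-window error of the
§9 pair as `∫ (eddy term + transport term) dσ`, the transport term at time `t` being the Fourier flux of the FINE level `E.b (m+1) t` on the
true solution `w` against the coarse adjoint field `ψ`:  `Σ'ₖ Σⱼ 2πikⱼ ⟪𝓕((b_{m+1})ⱼ w)(k), ψ̂(k)⟫_ℂ`.  Memo L8 §2, brick Z6: in the
Lagrangian frame `X = E.X m t (j'·refresh (m+1))` of the coarse flow (restarted at the window's left end, `t ∈ window (m+1) j'`) this term is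
EXACTLY the flat transport term of the composed fields — `b_{m+1}` becomes the EULERIAN lattice level `E.level (m+1) t` (frozen-in insertion
`IsInserted`: `b_{m+1}(t, X y) = DX(y)·level(t, y)`), the volume form is preserved (`LevelRegular` (F2c)) and `∇ψ∘X` recombines with `DX` into
`∇(ψ∘X)` (the `H¹` chain rule Z5, `LagrangianLatticeCarrier.frameChainRule`, ad-lit p682792):

* `hasSum_transport_fourier` — Fourier ↔ physical form of the transport pairing (generic `𝕋^d`): for `ψ ∈ L²` with weak gradient
  `g ∈ L²` and `βⱼ w ∈ L²`, `Σ'ₖ Σⱼ 2πikⱼ⟪𝓕(βⱼ w)(k), ψ̂(k)⟫_ℂ = Σⱼ ∫ ⟪βⱼ w, gⱼ⟫` (Parseval + `ĝⱼ(k) = 2πikⱼψ̂(k)`);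
* `sum_inner_coord_smul_eq`, `integral_transport_frame` — the pointwise / integrated frame identity
  `∫ Σⱼ ⟪(b_{m+1})ⱼ(t,x) w(x), gⱼ(x)⟫ dx = ∫ ⟪w(X y), Σₐ levelₐ(t,y) · Σⱼ (DX(y)eₐ)ⱼ gⱼ(X y)⟫ dy`;
* `memLp_coord_smul`, `memLp_frameDeriv`, `aestronglyMeasurable_transport_density` — the bookkeeping (`L²`-ness of the frame gradient;
  `LerayHopfProofs.integrable_inner_of_memLp_two` reused);
* **`tsum_transport_frame`** — Z6-T: `Σ'ₖ Σⱼ 2πikⱼ ⟪𝓕((b_{m+1}(t))ⱼ w)(k), ψ̂(k)⟫ = Σ'ₖ Σₐ 2πikₐ ⟪𝓕((level_{m+1}(t))ₐ (w∘X))(k), 𝓕(ψ∘X)(k)⟫`.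

The eddy term's frame form (Z6-E) and the distortion transfer (Z7) are separate.  NOT a proof of §9z, of the crux, or of AD; rung F-D1.A0.
-/

set_option linter.dupNamespace false  -- the summit-side namespace `Summit.AnomalousDissipation.AnomalousDissipation.…` repeats a component by design (D-0017)

noncomputable section

namespace Summit.AnomalousDissipation.AnomalousDissipation.Theorems.SolenoidalFractalHomogenisation.LagrangianStep.FrameForm

open Literature.Analysis Literature.Analysis.FluidPDE Literature.Analysis.FunctionSpaces Literature.Analysis.FunctionSpaces.Torus
open MeasureTheory Set Filter UnitAddTorus Function
open scoped ENNReal NNReal InnerProductSpace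
open Literature.Analysis.FluidPDE.LatticeShear (LagrangianLatticeCarrier FractalCarrierData)
open Summit.AnomalousDissipation.AnomalousDissipation.Theorems.SolenoidalFractalHomogenisation.LagrangianRenormalisationStep (continuous_uncurry_level)

/-! ## §1 Fourier coefficients of weak derivatives (private copies, complexified) -/

section Coefficients

variable {d : Type*} [Fintype d] [DecidableEq d] {F : Type*} [NormedAddCommGroup F] [NormedSpace ℂ F]

omit [DecidableEq d] in
/-- `∫ ψ • h = ∫ (Re ψ) • h + i ∫ (Im ψ) • h` for smooth `ψ : 𝕋^d → ℂ` and integrable `h`.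
-- adapted from `Literature/Analysis/FluidPDE/LagrangianLatticeCarrierFrameChainRule.lean` (private there) -/
private theorem integral_smul_eq_re_add_I_smul_im₆ {ψ : UnitAddTorus d → ℂ} (hψ : IsSmooth ψ)
    {h : UnitAddTorus d → F} (hh : Integrable h volume) :
    ∫ x, ψ x • h x = (∫ x, (ψ x).re • h x) + Complex.I • ∫ x, (ψ x).im • h x := by
  have hre : IsSmooth fun x => (ψ x).re := hψ.comp_clm Complex.reCLM
  have him : IsSmooth fun x => (ψ x).im := hψ.comp_clm Complex.imCLM
  have h2i : Integrable (fun x => Complex.I • ((ψ x).im • h x)) volume :=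
    (him.integrable_smul hh).smul Complex.I
  rw [← integral_smul, ← integral_add (hre.integrable_smul hh) h2i]
  refine integral_congr_ae (ae_of_all _ fun x => ?_)
  beta_reduce
  calc ψ x • h x = (((ψ x).re : ℂ) + ((ψ x).im : ℂ) * Complex.I) • h x := by rw [Complex.re_add_im]
    _ = ((ψ x).re : ℂ) • h x + Complex.I • (((ψ x).im : ℂ) • h x) := by
        rw [add_smul, mul_comm, mul_smul]
    _ = (ψ x).re • h x + Complex.I • ((ψ x).im • h x) := by
        rw [Complex.coe_smul, Complex.coe_smul]

/-- `ĝ(n) = 2πi nᵢ f̂(n)` for a weak `i`-th partial derivative `g` of `f` (both integrable, complex values): test the weak identity with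
`Re e_{-n}`, `Im e_{-n}`.
-- adapted from `Literature/Analysis/FluidPDE/LagrangianLatticeCarrierFrameChainRule.lean` (private there) -/
private theorem mFourierCoeff_eq_of_hasWeakPartialDeriv₆ {i : d} {f g : UnitAddTorus d → F}
    (hf : Integrable f volume) (hg : Integrable g volume) (h : HasWeakPartialDeriv i f g)
    (n : d → ℤ) :
    mFourierCoeff g n = (2 * Real.pi * Complex.I * (n i)) • mFourierCoeff f n := by
  have hχ : IsSmooth (⇑(mFourier (-n)) : UnitAddTorus d → ℂ) := isSmooth_mFourier (-n)
  have hre : IsSmooth fun y => (mFourier (-n) y).re := hχ.comp_clm Complex.reCLM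
  have him : IsSmooth fun y => (mFourier (-n) y).im := hχ.comp_clm Complex.imCLM
  set c : ℂ := 2 * Real.pi * Complex.I * ((-n) i) with hc
  have hcχ : IsSmooth (fun x => c * mFourier (-n) x) := contDiff_const.mul hχ
  have hdre : ∀ x, partialDeriv i (fun y => (mFourier (-n) y).re) x = (c * mFourier (-n) x).re :=
    fun x => by
    have h1 := partialDeriv_clm_comp hχ Complex.reCLM i x
    rw [partialDeriv_mFourier] at h1
    exact h1
  have hdim : ∀ x, partialDeriv i (fun y => (mFourier (-n) y).im) x = (c * mFourier (-n) x).im :=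
    fun x => by
    have h1 := partialDeriv_clm_comp hχ Complex.imCLM i x
    rw [partialDeriv_mFourier] at h1
    exact h1
  have h1 := h (fun y => (mFourier (-n) y).re) hre
  have h2 := h (fun y => (mFourier (-n) y).im) him
  beta_reduce at h1 h2
  simp_rw [hdre] at h1
  simp_rw [hdim] at h2
  have h1' : ∫ x, (mFourier (-n) x).re • g x = -∫ x, (c * mFourier (-n) x).re • f x := by
    rw [h1, neg_neg]
  have h2' : ∫ x, (mFourier (-n) x).im • g x = -∫ x, (c * mFourier (-n) x).im • f x := by
    rw [h2, neg_neg]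
  calc mFourierCoeff g n = ∫ x, mFourier (-n) x • g x := mFourierCoeff_eq_integral_volume g n
    _ = (∫ x, (mFourier (-n) x).re • g x) + Complex.I • ∫ x, (mFourier (-n) x).im • g x :=
        integral_smul_eq_re_add_I_smul_im₆ hχ hg
    _ = -((∫ x, (c * mFourier (-n) x).re • f x) +
          Complex.I • ∫ x, (c * mFourier (-n) x).im • f x) := by
        rw [h1', h2', smul_neg, neg_add]
    _ = -∫ x, (c * mFourier (-n) x) • f x := by rw [integral_smul_eq_re_add_I_smul_im₆ hcχ hf]
    _ = -(c • mFourierCoeff f n) := by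
        rw [mFourierCoeff_eq_integral_volume, ← integral_smul]
        congr 1
        refine integral_congr_ae (ae_of_all _ fun x => ?_)
        simp only [smul_smul]
    _ = (2 * Real.pi * Complex.I * (n i)) • mFourierCoeff f n := by
        rw [← neg_smul]
        congr 1
        simp only [hc, Pi.neg_apply, Int.cast_neg]
        ring

/-- Complexification of a weak derivative of a real vector field.
-- adapted from `Literature/Analysis/FluidPDE/LagrangianLatticeCarrierFrameChainRule.lean` (private there) -/
private theorem hasWeakPartialDeriv_complexify₆ {i : d} {f g : UnitAddTorus d → EuclideanSpace ℝ d}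
    (h : HasWeakPartialDeriv i f g) :
    HasWeakPartialDeriv i (EuclideanSpace.complexify ∘ f) (EuclideanSpace.complexify ∘ g) := by
  intro φ hφ
  have e1 : (fun x => partialDeriv i φ x • (EuclideanSpace.complexify ∘ f) x) =
      fun x => EuclideanSpace.complexify (partialDeriv i φ x • f x) := by
    funext x
    simp only [Function.comp_apply, map_smul]
  have e2 : (fun x => φ x • (EuclideanSpace.complexify ∘ g) x) =
      fun x => EuclideanSpace.complexify (φ x • g x) := by
    funext x
    simp only [Function.comp_apply, map_smul]
  rw [e1, e2, LinearIsometry.integral_comp_comm, LinearIsometry.integral_comp_comm, h φ hφ, map_neg]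

/-- `𝓕(complexify ∘ g)(n) = 2πi nᵢ 𝓕(complexify ∘ f)(n)` for a weak `i`-th partial derivative `g` of a real vector field `f`.
-- adapted from `Literature/Analysis/FluidPDE/LagrangianLatticeCarrierFrameChainRule.lean` (private there) -/
private theorem mFourierCoeff_complexify_eq_of_hasWeakPartialDeriv₆ {i : d}
    {f g : UnitAddTorus d → EuclideanSpace ℝ d} (hf : Integrable f volume) (hg : Integrable g volume)
    (h : HasWeakPartialDeriv i f g) (n : d → ℤ) :
    mFourierCoeff (EuclideanSpace.complexify ∘ g) n =
      (2 * Real.pi * Complex.I * (n i)) • mFourierCoeff (EuclideanSpace.complexify ∘ f) n := by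
  have hf' : Integrable (EuclideanSpace.complexify ∘ f) volume :=
    EuclideanSpace.complexify.toContinuousLinearMap.integrable_comp hf
  have hg' : Integrable (EuclideanSpace.complexify ∘ g) volume :=
    EuclideanSpace.complexify.toContinuousLinearMap.integrable_comp hg
  exact mFourierCoeff_eq_of_hasWeakPartialDeriv₆ hf' hg' (hasWeakPartialDeriv_complexify₆ h) n

end Coefficients

/-! ## §2 The transport pairing: Fourier form ↔ physical form (generic `𝕋^d`) -/

section Generic

variable {d : Type*} [Fintype d] [DecidableEq d]

omit [DecidableEq d] in
/-- A continuous coordinate multiplier keeps a vector field in `L²`: `βⱼ • w ∈ L²` for continuous `β` and `w ∈ L²` (compact torus). -/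
theorem memLp_coord_smul {β w : UnitAddTorus d → EuclideanSpace ℝ d} (hβ : Continuous β) (hw : MemLp w 2 volume) (j : d) :
    MemLp (fun z => β z j • w z) 2 volume := by
  obtain ⟨C, hC⟩ := isCompact_univ.exists_bound_of_continuousOn hβ.continuousOn
  have hβj : Continuous fun z => β z j := (PiLp.continuous_apply 2 _ j).comp hβ
  refine MemLp.of_le_mul (c := C) hw (hβj.aestronglyMeasurable.smul hw.1) (ae_of_all _ fun x => ?_)
  rw [norm_smul]
  exact mul_le_mul_of_nonneg_right ((PiLp.norm_apply_le (β x) j).trans (hC x (mem_univ _))) (norm_nonneg _)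

/-- **The transport pairing, Fourier ↔ physical** (Parseval + `ĝⱼ(k) = 2πikⱼ ψ̂(k)`): for `ψ ∈ L²(𝕋^d; ℝ^d)` with weak partial derivatives
`gⱼ ∈ L²` and `βⱼ • w ∈ L²` (`j ∈ d`),
`Σ'ₖ Σⱼ 2πikⱼ ⟪𝓕(complexify ∘ (βⱼ • w))(k), 𝓕(complexify ∘ ψ)(k)⟫_ℂ = Σⱼ ∫ ⟪βⱼ • w, gⱼ⟫_ℝ` (as a `HasSum` in `ℂ`). -/
theorem hasSum_transport_fourier {β w ψ : UnitAddTorus d → EuclideanSpace ℝ d} {g : d → UnitAddTorus d → EuclideanSpace ℝ d}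
    (hβw : ∀ j, MemLp (fun z => β z j • w z) 2 volume) (hψ : MemLp ψ 2 volume) (hg : ∀ j, MemLp (g j) 2 volume)
    (hwd : ∀ j, HasWeakPartialDeriv j ψ (g j)) :
    HasSum (fun k' : d → ℤ => ∑ j, (2 * Real.pi * Complex.I * (k' j)) *
        ⟪mFourierCoeff (EuclideanSpace.complexify ∘ fun z => β z j • w z) k', mFourierCoeff (EuclideanSpace.complexify ∘ ψ) k'⟫_ℂ)
      (((∑ j, ∫ x, ⟪β x j • w x, g j x⟫_ℝ : ℝ) : ℂ)) := by
  have hψi : Integrable ψ volume := hψ.integrable one_le_two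
  have hcoef : ∀ j (k' : d → ℤ), mFourierCoeff (EuclideanSpace.complexify ∘ g j) k' =
      (2 * Real.pi * Complex.I * (k' j)) • mFourierCoeff (EuclideanSpace.complexify ∘ ψ) k' := fun j k' =>
    mFourierCoeff_complexify_eq_of_hasWeakPartialDeriv₆ hψi ((hg j).integrable one_le_two) (hwd j) k'
  have hj : ∀ j, HasSum (fun k' : d → ℤ => (2 * Real.pi * Complex.I * (k' j)) *
      ⟪mFourierCoeff (EuclideanSpace.complexify ∘ fun z => β z j • w z) k', mFourierCoeff (EuclideanSpace.complexify ∘ ψ) k'⟫_ℂ)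
      ((∫ x, ⟪β x j • w x, g j x⟫_ℝ : ℝ) : ℂ) := by
    intro j
    have h := hasSum_inner_mFourierCoeff_complexify (hβw j) (hg j)
    have e : (fun k' : d → ℤ => (2 * Real.pi * Complex.I * (k' j)) *
        ⟪mFourierCoeff (EuclideanSpace.complexify ∘ fun z => β z j • w z) k', mFourierCoeff (EuclideanSpace.complexify ∘ ψ) k'⟫_ℂ) =
        fun k' => ⟪mFourierCoeff (EuclideanSpace.complexify ∘ fun z => β z j • w z) k',
          mFourierCoeff (EuclideanSpace.complexify ∘ g j) k'⟫_ℂ := by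
      funext k'
      rw [hcoef j k', inner_smul_right]
    rw [e]
    exact h
  have := hasSum_sum (s := Finset.univ) fun j _ => hj j
  push_cast
  exact this

end Generic

/-! ## §3 The fine level in the frame of the coarse window flow -/

variable {k : ℕ}

/-- `flowDeriv` is linear: `DX(y) v = Σₐ vₐ · DX(y) eₐ`. -/
theorem flowDeriv_apply_eq_sum (E : LagrangianLatticeCarrier k) (m : ℕ) (t s : ℝ) (y : UnitAddTorus (Fin 3)) (v : EuclideanSpace ℝ (Fin 3)) :
    E.flowDeriv m t s y v = ∑ a, v a • E.flowDeriv m t s y (EuclideanSpace.single a (1:ℝ)) := by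
  conv_lhs => rw [← (EuclideanSpace.basisFun (Fin 3) ℝ).sum_repr v]
  simp only [map_sum, map_smul, EuclideanSpace.basisFun_apply, EuclideanSpace.basisFun_repr]

/-- **Frozen-in insertion, expanded**: for `t` in the refresh window `j'` of level `m+1`,
`b_{m+1}(t, X y) = Σₐ level_{m+1}(t, y)ₐ · DX(y) eₐ` with `X = E.X m t (j'·refresh (m+1))`, `DX = E.flowDeriv m t (j'·refresh (m+1))`. -/
theorem b_succ_X_eq_sum (E : LagrangianLatticeCarrier k) (hL : E.IsLagrangian) (m : ℕ) (j' : ℤ) {t : ℝ} (ht : t ∈ E.window (m + 1) j')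
    (y : UnitAddTorus (Fin 3)) :
    E.b (m + 1) t (E.X m t ((j' : ℝ) * E.refresh (m + 1)) y) =
      ∑ a, (E.toFractalCarrierData.level (m + 1) t y) a •
        E.flowDeriv m t ((j' : ℝ) * E.refresh (m + 1)) y (EuclideanSpace.single a (1:ℝ)) := by
  rw [(hL m).2 j' t ht y, flowDeriv_apply_eq_sum]

/-- Coordinates of the inserted level: `(b_{m+1})ⱼ(t, X y) = Σₐ level_{m+1}(t,y)ₐ · (DX(y) eₐ)ⱼ`. -/
theorem b_succ_X_apply (E : LagrangianLatticeCarrier k) (hL : E.IsLagrangian) (m : ℕ) (j' : ℤ) {t : ℝ} (ht : t ∈ E.window (m + 1) j')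
    (y : UnitAddTorus (Fin 3)) (j : Fin 3) :
    E.b (m + 1) t (E.X m t ((j' : ℝ) * E.refresh (m + 1)) y) j =
      ∑ a, (E.toFractalCarrierData.level (m + 1) t y) a *
        (E.flowDeriv m t ((j' : ℝ) * E.refresh (m + 1)) y (EuclideanSpace.single a (1:ℝ))) j := by
  rw [b_succ_X_eq_sum E hL m j' ht y]
  simp only [WithLp.ofLp_sum, WithLp.ofLp_smul, Finset.sum_apply, Pi.smul_apply, smul_eq_mul]

/-- **The transport density at a frame point** (pure algebra on `IsInserted`): for any vectors `W`, `Gⱼ`,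
`Σⱼ ⟪(b_{m+1})ⱼ(t, X y) • W, Gⱼ⟫ = ⟪W, Σₐ level_{m+1}(t,y)ₐ • Σⱼ (DX(y) eₐ)ⱼ • Gⱼ⟫`. -/
theorem sum_inner_coord_smul_eq (E : LagrangianLatticeCarrier k) (hL : E.IsLagrangian) (m : ℕ) (j' : ℤ) {t : ℝ}
    (ht : t ∈ E.window (m + 1) j') (y : UnitAddTorus (Fin 3)) (W : EuclideanSpace ℝ (Fin 3)) (G : Fin 3 → EuclideanSpace ℝ (Fin 3)) :
    ∑ j, ⟪E.b (m + 1) t (E.X m t ((j' : ℝ) * E.refresh (m + 1)) y) j • W, G j⟫_ℝ =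
      ⟪W, ∑ a, (E.toFractalCarrierData.level (m + 1) t y) a •
        ∑ j, (E.flowDeriv m t ((j' : ℝ) * E.refresh (m + 1)) y (EuclideanSpace.single a (1:ℝ))) j • G j⟫_ℝ := by
  simp only [b_succ_X_apply E hL m j' ht y, inner_sum, real_inner_smul_left, real_inner_smul_right, Finset.sum_mul,
    Finset.mul_sum, mul_assoc]
  rw [Finset.sum_comm]

/-- The transport density `x ↦ Σⱼ ⟪(b_{m+1})ⱼ(t,x) • w x, gⱼ x⟫` is a.e.-strongly measurable for a.e.-strongly measurable `w`, `gⱼ`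
(the level field is continuous, `LevelRegular` (L1)). -/
theorem aestronglyMeasurable_transport_density (E : LagrangianLatticeCarrier k) (hR : E.LevelRegular) (m : ℕ) (t : ℝ)
    {w : VF} {g : Fin 3 → VF} (hw : AEStronglyMeasurable w volume) (hg : ∀ j, AEStronglyMeasurable (g j) volume) :
    AEStronglyMeasurable (fun x => ∑ j, ⟪E.b (m + 1) t x j • w x, g j x⟫_ℝ) volume := by
  have hb : Continuous (E.b (m + 1) t) := (hR.continuous_uncurry_b m).uncurry_left t
  refine Finset.aestronglyMeasurable_sum (μ := volume) (f := fun j x => ⟪E.b (m + 1) t x j • w x, g j x⟫_ℝ)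
    (Finset.univ : Finset (Fin 3)) fun j _ => ?_
  exact ((((PiLp.continuous_apply 2 _ j).comp hb).aestronglyMeasurable.smul hw).inner (hg j))

/-- **The transport pairing in the frame** (change of variables under the measure-preserving window flow + frozen-in insertion):
`∫ Σⱼ ⟪(b_{m+1})ⱼ(t,x) • w(x), gⱼ(x)⟫ dx = ∫ ⟪w(X y), Σₐ level_{m+1}(t,y)ₐ • Σⱼ (DX(y)eₐ)ⱼ • gⱼ(X y)⟫ dy`,
`X = E.X m t (j'·refresh (m+1))`, `t ∈ window (m+1) j'`. -/
theorem integral_transport_frame (E : LagrangianLatticeCarrier k) (hR : E.LevelRegular) (hL : E.IsLagrangian) (m : ℕ) (j' : ℤ) {t : ℝ}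
    (ht : t ∈ E.window (m + 1) j') {w : VF} {g : Fin 3 → VF}
    (hF : AEStronglyMeasurable (fun x => ∑ j, ⟪E.b (m + 1) t x j • w x, g j x⟫_ℝ) volume) :
    ∫ x, ∑ j, ⟪E.b (m + 1) t x j • w x, g j x⟫_ℝ =
      ∫ y, ⟪w (E.X m t ((j' : ℝ) * E.refresh (m + 1)) y), ∑ a, (E.toFractalCarrierData.level (m + 1) t y) a •
        ∑ j, (E.flowDeriv m t ((j' : ℝ) * E.refresh (m + 1)) y (EuclideanSpace.single a (1:ℝ))) j •
          g j (E.X m t ((j' : ℝ) * E.refresh (m + 1)) y)⟫_ℝ := by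
  rw [← integral_comp_X E hR m t ((j' : ℝ) * E.refresh (m + 1)) hF]
  refine integral_congr_ae (ae_of_all _ fun y => ?_)
  exact sum_inner_coord_smul_eq E hL m j' ht y _ _

/-- The Jacobian entries `y ↦ (DX(y) eₐ)ⱼ` of a window flow are continuous (`LevelRegular` (F1b)). -/
theorem continuous_flowDeriv_entry (E : LagrangianLatticeCarrier k) (hR : E.LevelRegular) (m : ℕ) (j' : ℤ) (t : ℝ) (a j : Fin 3) :
    Continuous fun y => (E.flowDeriv m t ((j' : ℝ) * E.refresh (m + 1)) y (EuclideanSpace.single a (1:ℝ))) j := by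
  have h := (hR.isSmooth_flowDeriv_entry m j' (t - (j' : ℝ) * E.refresh (m + 1)) j a).continuous
  rwa [show (j' : ℝ) * E.refresh (m + 1) + (t - (j' : ℝ) * E.refresh (m + 1)) = t by ring] at h

/-- **The frame gradient is in `L²`**: `y ↦ Σⱼ (DX(y)eₐ)ⱼ • gⱼ(X y) ∈ L²` for `gⱼ ∈ L²` (bounded continuous Jacobian entries, measure
preservation). -/
theorem memLp_frameDeriv (E : LagrangianLatticeCarrier k) (hR : E.LevelRegular) (m : ℕ) (j' : ℤ) (t : ℝ) {g : Fin 3 → VF}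
    (hg : ∀ j, MemLp (g j) 2 volume) (a : Fin 3) :
    MemLp (fun y => ∑ j, (E.flowDeriv m t ((j' : ℝ) * E.refresh (m + 1)) y (EuclideanSpace.single a (1:ℝ))) j •
      g j (E.X m t ((j' : ℝ) * E.refresh (m + 1)) y)) 2 volume := by
  refine memLp_finsetSum' (μ := volume) (f := fun j y => (E.flowDeriv m t ((j' : ℝ) * E.refresh (m + 1)) y (EuclideanSpace.single a (1:ℝ))) j •
      g j (E.X m t ((j' : ℝ) * E.refresh (m + 1)) y)) (Finset.univ : Finset (Fin 3)) fun j _ => ?_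
  have hcont := continuous_flowDeriv_entry E hR m j' t a j
  obtain ⟨C, hC⟩ := isCompact_univ.exists_bound_of_continuousOn hcont.continuousOn
  have hgX : MemLp (fun y => g j (E.X m t ((j' : ℝ) * E.refresh (m + 1)) y)) 2 volume :=
    memLp_comp_X E hR m t _ (hg j)
  refine MemLp.of_le_mul (c := C) hgX (hcont.aestronglyMeasurable.smul hgX.1) (ae_of_all _ fun y => ?_)
  rw [norm_smul]
  exact mul_le_mul_of_nonneg_right (hC y (mem_univ _)) (norm_nonneg _)

/-- The Eulerian lattice level field is continuous in `x` at every time. -/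
theorem continuous_level (E : LagrangianLatticeCarrier k) (m : ℕ) (t : ℝ) :
    Continuous (E.toFractalCarrierData.level (m + 1) t) :=
  (continuous_uncurry_level E.toFractalCarrierData (m + 1)).uncurry_left t

/-- **Z6-T — the transport term of the window cross density IS the flat transport term in the frame.**  For a regular Lagrangian
carrier (`E.Regular`, `E.IsLagrangian`), `t ∈ window (m+1) j'`, `X = E.X m t (j'·refresh (m+1))`, `w ∈ L²` and `ψ ∈ L²` with weak gradient
`g ∈ L²`:
`Σ'ₖ Σⱼ 2πikⱼ ⟪𝓕((b_{m+1}(t))ⱼ • w)(k), ψ̂(k)⟫_ℂ = Σ'ₖ Σₐ 2πikₐ ⟪𝓕((level_{m+1}(t))ₐ • (w∘X))(k), 𝓕(ψ∘X)(k)⟫_ℂ`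
(both sides `= Σⱼ∫⟪(b_{m+1})ⱼ w, gⱼ⟫ = ∫⟪w∘X, (level·∇)(ψ∘X)⟫`; the weak gradient of `ψ∘X` is the frame gradient, Z5 `frameChainRule`). -/
theorem tsum_transport_frame (E : LagrangianLatticeCarrier k) (hR : E.Regular) (hL : E.IsLagrangian) (m : ℕ) (j' : ℤ) {t : ℝ}
    (ht : t ∈ E.window (m + 1) j') {w ψ : VF} {g : Fin 3 → VF}
    (hw : MemLp w 2 volume) (hψ : MemLp ψ 2 volume) (hg : ∀ j, MemLp (g j) 2 volume) (hwd : ∀ j, HasWeakPartialDeriv j ψ (g j)) :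
    ∑' k' : Fin 3 → ℤ, ∑ j, (2 * Real.pi * Complex.I * (k' j)) *
        ⟪mFourierCoeff (EuclideanSpace.complexify ∘ fun z => E.b (m + 1) t z j • w z) k',
          mFourierCoeff (EuclideanSpace.complexify ∘ ψ) k'⟫_ℂ =
      ∑' k' : Fin 3 → ℤ, ∑ a, (2 * Real.pi * Complex.I * (k' a)) *
        ⟪mFourierCoeff (EuclideanSpace.complexify ∘ fun y =>
            (E.toFractalCarrierData.level (m + 1) t y) a • w (E.X m t ((j' : ℝ) * E.refresh (m + 1)) y)) k',
          mFourierCoeff (EuclideanSpace.complexify ∘ fun y => ψ (E.X m t ((j' : ℝ) * E.refresh (m + 1)) y)) k'⟫_ℂ := by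
  have hLR := hR.levelRegular
  have hb : Continuous (E.b (m + 1) t) := (hLR.continuous_uncurry_b m).uncurry_left t
  -- physical form of the left-hand side
  have hLHS := (hasSum_transport_fourier (fun j => memLp_coord_smul hb hw j) hψ hg hwd).tsum_eq
  -- the frame data
  have hwX : MemLp (fun y => w (E.X m t ((j' : ℝ) * E.refresh (m + 1)) y)) 2 volume := memLp_comp_X E hLR m t ((j' : ℝ) * E.refresh (m + 1)) hw
  obtain ⟨hψX, hwdX⟩ := LatticeShear.LagrangianLatticeCarrier.frameChainRule k E hR m t ((j' : ℝ) * E.refresh (m + 1)) ψ g hψ hg hwd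
  have hGX : ∀ a, MemLp (fun y => ∑ j, (E.flowDeriv m t ((j' : ℝ) * E.refresh (m + 1)) y (EuclideanSpace.single a (1:ℝ))) j • g j (E.X m t ((j' : ℝ) * E.refresh (m + 1)) y)) 2 volume :=
    fun a => memLp_frameDeriv E hLR m j' t hg a
  have hRHS := (hasSum_transport_fourier (fun a => memLp_coord_smul (continuous_level E m t) hwX a) hψX hGX hwdX).tsum_eq
  rw [hLHS, hRHS]
  congr 1
  -- the two physical forms agree: change of variables + insertion
  have hI : ∀ j, Integrable (fun x => ⟪E.b (m + 1) t x j • w x, g j x⟫_ℝ) volume := fun j =>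
    integrable_inner_of_memLp_two (memLp_coord_smul hb hw j) (hg j)
  have hI' : ∀ a, Integrable (fun y => ⟪(E.toFractalCarrierData.level (m + 1) t y) a • w (E.X m t ((j' : ℝ) * E.refresh (m + 1)) y),
      ∑ j, (E.flowDeriv m t ((j' : ℝ) * E.refresh (m + 1)) y (EuclideanSpace.single a (1:ℝ))) j • g j (E.X m t ((j' : ℝ) * E.refresh (m + 1)) y)⟫_ℝ) volume := fun a =>
    integrable_inner_of_memLp_two (memLp_coord_smul (continuous_level E m t) hwX a) (hGX a)
  rw [← integral_finsetSum Finset.univ (fun j _ => hI j), ← integral_finsetSum Finset.univ (fun a _ => hI' a),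
    integral_transport_frame E hLR hL m j' ht
      (aestronglyMeasurable_transport_density E hLR m t hw.1 fun j => (hg j).1)]
  refine integral_congr_ae (ae_of_all _ fun y => ?_)
  simp only [inner_sum, real_inner_smul_left, real_inner_smul_right, Finset.mul_sum]
  exact Finset.sum_congr rfl fun a _ => Finset.sum_congr rfl fun j _ => by ring

end Summit.AnomalousDissipation.AnomalousDissipation.Theorems.SolenoidalFractalHomogenisation.LagrangianStep.FrameForm

end
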